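import Summits.QuantumAdvantage.QuantumAdvantage.Theses.CharDial
import Summits.QuantumAdvantage.QuantumAdvantage.Theorems.CharDialSubCharJunta

/-!
# CharDial — `SubCharHardOdd` (stmt-QuantumAdvantage-32602) holds

The sub-characteristic junta law of lens-6 g8 «CharDial» (critic row 47 VERIFIED; tree modules
`Theorems.CharDialWalkHardFSubLog → CharDialSubCharCombinatorics → CharDialSubCharBlocks → CharDialSubCharJunta`):
for every prime `p ≥ 5` and every degree `d ≤ p − 2`, a ring strategy whose outputs have `𝔽_p`-degree `≤ d` wins the
odd-prime walk game `ringWinU c` on at most a `θ < 1` fraction of inputs, for all large `n` — the node's NOTCH 3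
`SubCharHardOdd`, i.e. `WalkHardFDeg p d` for `d + 2 ≤ p`, by name `AdviceFreeQNC0.walkHardF_subChar_of_five_le`.

Cell decomp-qadv (D-0178/D-0179), census seat decomp-qadv-census-1 g6 (prover lane); mathematics: lens-6 g7/g8.
-/

set_option linter.dupNamespace false -- D-0017: single-problem summit ⇒ `QuantumAdvantage.QuantumAdvantage` by design

namespace Summit.QuantumAdvantage.QuantumAdvantage.Theorems

/-- **`CharDial.SubCharHardOdd` holds** (aside stmt-QuantumAdvantage-32602): sub-characteristic constant-degree
strategies (`𝔽_p`-degree `≤ p − 2`, `p ≥ 5`) lose the odd-prime walk game on a constant fraction of inputs. -/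
theorem charDial_subCharHardOdd : Summit.QuantumAdvantage.QuantumAdvantage.Theses.CharDial.SubCharHardOdd :=
  fun p _ hp d hd => Summit.QuantumAdvantage.AdviceFreeQNC0.walkHardF_subChar_of_five_le p hp d hd

end Summit.QuantumAdvantage.QuantumAdvantage.Theorems
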